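import Summits.CriticalPhenomena.SAWScalingLimit.Theorems.SAWWeldingIdentificationWeldingLawOfLimitReductions
import Summits.CriticalPhenomena.SAWScalingLimit.Theorems.SAWWeldingIdentificationLimitUpgrade

/-!
# The canonical welding law is what route `SAWWeldingIdentification` needs of its crux (W)

Crux `WeldingLawOfLimit` (stmt-CriticalPhenomena-4502), line `registered`, held stub
`stub_canonicalWeldingLaw` (`CanonicalWeldingLaw`: for every CHORD-SUPPORTED subsequential weak limit
`P` of the critical `ℤ²` SAW laws in `(Q.chord 0 2; a_δ, b_δ)` and every chordal SLE_{8/3} curve `Γ`,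
the finite-dimensional laws of the ONE Literature functional `conformalWelding Q γ` at positive
points agree under `P` and under `ℙ ∘ Γ⁻¹`). This support file (lead c2) records, kernel-checked and
with the stub statement inlined as the hypothesis `hC`, that the stub ALONE — without the shared
simplicity crux `SimpleSubseqLimits` (stmt-4982, stub 1 of the line) and without the arbitrary
pinned functional `W` of the crux — is what the route consumes:

* `weldingLawOfLimit_of_canonical_of_removableLimit`: `CanonicalWeldingLaw ∧ RemovableLimit ⇒ (W)`
  (the sibling crux (R), stmt-4503, already carries chord support of every subsequential limit, so
  it replaces stub 1 in the skeleton's composition `weldingLawOfLimit_of_chordSupport_of_canonical`);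
* `subseqIdentification_of_canonical_of_removableLimit`:
  `CanonicalWeldingLaw ∧ RemovableLimit ⇒ SubseqIdentification` (stmt-0783, the shared
  identification crux; with `weldingLawOfLimit_of_subseqIdentification` and
  `map_conformalWelding_eq_of_weldingLawOfLimit`: modulo (R), stub 2 ⟺ (W) ⟺ stmt-0783);
* `sawScalingLimit_of_canonical_of_removableLimit_of_eventualTight`:
  `CanonicalWeldingLaw ∧ RemovableLimit ∧ EventualTight ⇒ SAWScalingLimit` — the route's deciding
  theorem `closes` with its six supports discharged by their tree proofs and its crux (W) replaced by
  the canonical welding law.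

No new definition, no named fact; all ingredients are proved tree theorems.
-/

noncomputable section

open MeasureTheory Filter Topology Set
open Literature.Probability.RandomPlanarGeometry Literature.Probability.LatticeModels
open Literature.Probability.Process (preWienerMeasure)
open Summit.CriticalPhenomena.SAWScalingLimit.Theses

namespace Summit.CriticalPhenomena.SAWScalingLimit.Theorems.WeldingLawOfLimit

/-- **`RemovableLimit` gives chord support.** Under the sibling crux (R) every subsequential weak
limit of the critical SAW laws in `(Q.chord 0 2; a_δ, b_δ)` is carried by the simple chords of
`(Ω; a, b)` (first conjunct of (R); the chord clause of (R) is `IsSimpleChord` verbatim). [folklore] -/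
theorem ae_isSimpleChord_of_removableLimit (hR : SAWWeldingIdentification.RemovableLimit)
    (Q : ConformalRectangle) (a b : ℝ → Site 2)
    (hab : SAW.IsEndpointApprox (Q.chord 0 2 (by decide)) a b)
    (P : Measure (CurveClass ℂ)) (hP : IsProbabilityMeasure P)
    (δs : ℕ → ℝ) (hpos : ∀ n, 0 < δs n) (hδ : Tendsto δs atTop (𝓝 0))
    (hlim : ∀ f : BoundedContinuousFunction (CurveClass ℂ) ℝ,
      Tendsto (fun n => ∫ γ, f γ.curve ∂(SAW.law Q.carrier (δs n) (a (δs n)) (b (δs n))))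
        atTop (𝓝 (∫ γ, f γ ∂P))) :
    ∀ᵐ γ ∂P, (Q.chord 0 2 (by decide)).IsSimpleChord γ :=
  (hR Q a b hab P hP δs hpos hδ hlim).mono fun _ h => h.1

/-- **`CanonicalWeldingLaw ∧ RemovableLimit ⇒ (W).`** If for every chord-supported subsequential
weak limit `P` and every chordal SLE_{8/3} curve `Γ` the finite-dimensional laws of
`conformalWelding` at positive points agree under `P` and `ℙ ∘ Γ⁻¹` (`hC`, the line's stub 2
verbatim), and (R) holds, then `WeldingLawOfLimit` holds for EVERY pinned measurable functional `W`:
(R) supplies the chord support that the skeleton otherwise takes from `SimpleSubseqLimits`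
(stmt-4982), and `weldingLawOfLimit_of_chordSupport_of_canonical` composes. [folklore] -/
theorem weldingLawOfLimit_of_canonical_of_removableLimit :
    (∀ (Q : ConformalRectangle) (a b : ℝ → Site 2),
      SAW.IsEndpointApprox (Q.chord 0 2 (by decide)) a b →
      ∀ (P : Measure (CurveClass ℂ)), IsProbabilityMeasure P →
      ∀ (δs : ℕ → ℝ), (∀ n, 0 < δs n) → Tendsto δs atTop (𝓝 0) →
      (∀ f : BoundedContinuousFunction (CurveClass ℂ) ℝ,
        Tendsto (fun n => ∫ γ, f γ.curve ∂(SAW.law Q.carrier (δs n) (a (δs n)) (b (δs n))))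
          atTop (𝓝 (∫ γ, f γ ∂P))) →
      (∀ᵐ γ ∂P, (Q.chord 0 2 (by decide)).IsSimpleChord γ) →
      ∀ Γ : (NNReal → ℝ) → CurveClass ℂ, IsSLECurve ((8 : NNReal) / 3) (Q.chord 0 2 (by decide)) Γ →
      ∀ (k : ℕ) (x : Fin k → ℝ), (∀ i, 0 < x i) →
        P.map (fun γ i => conformalWelding Q γ (x i)) =
          (preWienerMeasure.map Γ).map (fun γ i => conformalWelding Q γ (x i))) →
    SAWWeldingIdentification.RemovableLimit → SAWWeldingIdentification.WeldingLawOfLimit :=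
  fun hC hR =>
    weldingLawOfLimit_of_chordSupport_of_canonical (ae_isSimpleChord_of_removableLimit hR) hC

/-- **`CanonicalWeldingLaw ∧ RemovableLimit ⇒ SubseqIdentification` (stmt-0783).** The canonical
welding law of chord-supported limits together with (R) identifies every subsequential weak limit of
the critical SAW laws in every Dobrushin domain with the chordal SLE_{8/3} law: compose
`weldingLawOfLimit_of_canonical_of_removableLimit` with `subseqIdentification_of_weldingLawOfLimit`
(welding set-up, rigidity, SLE removability and Lusin–Souslin, all proved in tree). This is the
route's thesis "read the stitching, know the curve" with the arbitrary functional `W` eliminated.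
[folklore] -/
theorem subseqIdentification_of_canonical_of_removableLimit :
    (∀ (Q : ConformalRectangle) (a b : ℝ → Site 2),
      SAW.IsEndpointApprox (Q.chord 0 2 (by decide)) a b →
      ∀ (P : Measure (CurveClass ℂ)), IsProbabilityMeasure P →
      ∀ (δs : ℕ → ℝ), (∀ n, 0 < δs n) → Tendsto δs atTop (𝓝 0) →
      (∀ f : BoundedContinuousFunction (CurveClass ℂ) ℝ,
        Tendsto (fun n => ∫ γ, f γ.curve ∂(SAW.law Q.carrier (δs n) (a (δs n)) (b (δs n))))
          atTop (𝓝 (∫ γ, f γ ∂P))) →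
      (∀ᵐ γ ∂P, (Q.chord 0 2 (by decide)).IsSimpleChord γ) →
      ∀ Γ : (NNReal → ℝ) → CurveClass ℂ, IsSLECurve ((8 : NNReal) / 3) (Q.chord 0 2 (by decide)) Γ →
      ∀ (k : ℕ) (x : Fin k → ℝ), (∀ i, 0 < x i) →
        P.map (fun γ i => conformalWelding Q γ (x i)) =
          (preWienerMeasure.map Γ).map (fun γ i => conformalWelding Q γ (x i))) →
    SAWWeldingIdentification.RemovableLimit → SAWLoopFugacityFlow.SubseqIdentification :=
  fun hC hR => subseqIdentification_of_weldingLawOfLimit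
    (weldingLawOfLimit_of_canonical_of_removableLimit hC hR) hR

/-- **`CanonicalWeldingLaw ∧ RemovableLimit ∧ EventualTight ⇒ SAWScalingLimit`.** The route's
deciding theorem `closes` with its crux (W) replaced by the canonical welding law of chord-supported
limits (stub 2 of line `registered`) and its six supports discharged by their tree proofs
(`WeldingSetup_proof`, `weldingRigidity_proof`, `SLERemovableChord_proof`,
`identifyFromWelding_proof`, `limitUpgrade_proof`, `ChordalSLE83Exists_holds`): what remains of the
route after this line is exactly stub 2, (R) = stmt-4503 and (T) = stmt-1372. [folklore] -/
theorem sawScalingLimit_of_canonical_of_removableLimit_of_eventualTight :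
    (∀ (Q : ConformalRectangle) (a b : ℝ → Site 2),
      SAW.IsEndpointApprox (Q.chord 0 2 (by decide)) a b →
      ∀ (P : Measure (CurveClass ℂ)), IsProbabilityMeasure P →
      ∀ (δs : ℕ → ℝ), (∀ n, 0 < δs n) → Tendsto δs atTop (𝓝 0) →
      (∀ f : BoundedContinuousFunction (CurveClass ℂ) ℝ,
        Tendsto (fun n => ∫ γ, f γ.curve ∂(SAW.law Q.carrier (δs n) (a (δs n)) (b (δs n))))
          atTop (𝓝 (∫ γ, f γ ∂P))) →
      (∀ᵐ γ ∂P, (Q.chord 0 2 (by decide)).IsSimpleChord γ) →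
      ∀ Γ : (NNReal → ℝ) → CurveClass ℂ, IsSLECurve ((8 : NNReal) / 3) (Q.chord 0 2 (by decide)) Γ →
      ∀ (k : ℕ) (x : Fin k → ℝ), (∀ i, 0 < x i) →
        P.map (fun γ i => conformalWelding Q γ (x i)) =
          (preWienerMeasure.map Γ).map (fun γ i => conformalWelding Q γ (x i))) →
    SAWWeldingIdentification.RemovableLimit → SAWWeldingIdentification.EventualTight →
      _root_.SAWScalingLimit :=
  fun hC hR hT =>
    SAWWeldingIdentification.closes (weldingLawOfLimit_of_canonical_of_removableLimit hC hR) hR hT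
      WeldingSetup_proof WeldingRigidity.weldingRigidity_proof SLERemovableChord_proof
      identifyFromWelding_proof limitUpgrade_proof
      -- buildfix 2026-08-19: `ChordalSLE83Exists_holds` is no longer linked in the route file; the tree theorem
      -- it unfolded to (Rohde–Schramm existence at κ = 8/3) is supplied instead (same proposition by δ-unfolding).
      (fun D => Literature.Probability.RandomPlanarGeometry.exists_isSLECurve_eightThirds D)

end Summit.CriticalPhenomena.SAWScalingLimit.Theorems.WeldingLawOfLimit

end
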